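import Literature.AlgebraicGeometry.Motives.PicardQuarticHypersurface
import Literature.AlgebraicGeometry.Motives.ZetaFunction
import Literature.NumberTheory.GaloisRepresentations.SuperellipticFrobeniusFixedPlaces
import HarnessLib

/-!
# Point counts of the Picard curve: the scheme `V₊(y³z - z⁴f(x/z))` versus the function field `k(x)[y]/(y³ - f)`

The junction between the two descriptions of the Picard curve `y³ = f(x)` (`f` a separable quartic,
`3 ≠ 0` in the ground field `k`) available in the tree:

* the **scheme** `X_F = V₊(F) ⊂ ℙ²_k`, `F` the Picard form — a smooth projective geometrically
  integral curve (`Motives/PicardQuarticHypersurface`), with its `k̄`-points, the action of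
  `Γ_k = Gal(k̄/k)` and, over a finite field, the counts `Motives.pointCount X_F m = #{P ∈ X_F(k̄) :
  φᵐ P = P}` (`Motives/ZetaFunction`: the numbers entering `Z(X_F, T)` and the Lefschetz trace
  formula of a Weil cohomology, `Motives/FrobeniusTrace`);
* the **function field** `Ω(C_f) = Ω(x)[y]/(y³ - f)` (`SuperellipticFunctionField k Ω 3 f`) with its
  places, the action of `Aut(Ω/k)`, divisor classes and Tate modules
  (`GaloisRepresentations/Superelliptic*`, `Picard*`), and the counts
  `AlgFunctionField.pointCount k (k(C_f)) m = N_m = Σ_{d ∣ m} d B_d`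
  (`DiophantineGeometry/FunctionFieldZeta`: the numbers entering `Z_{k(C_f)}(t)`, for which
  rationality, the functional equation and the Riemann hypothesis are PROVED in the tree).

Results (all proved, no named facts):

* `natCard_fixedPoints_eq_natCard_fixedPlaces` — for `Ω ⊇ k` algebraically closed and any
  `σ ∈ Aut(Ω/k)`: `#{P ∈ X_F(Ω) : σP = P} = #{Q place of Ω(C_f)/Ω : σQ = Q}` (both are
  `{∞} ⊔ {(a, b) : b³ = f(a), σa = a, σb = b}`: `PicardQuartic.fixedPointsEquiv` and
  `SuperellipticFunctionField.nonempty_fixedPlaces_equiv_option`).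
* `pointCount_hypersurface_picardForm` — over a finite field `k`:
  **`Motives.pointCount X_F m = AlgFunctionField.pointCount k (k(C_f)) m`** for `m ≥ 1`
  (with `SuperellipticFunctionField.natCard_fixedPlaces_frobenius_pow_eq_pointCount`), i.e.
  `#X_F(𝔽_{q^m}) = N_m(k(C_f))` — Weil's/Stichtenoth's identification of the zeta function of the
  curve with that of its function field, for this curve (Stichtenoth (5.16), (5.40); Hartshorne
  App. C §1).

Consequently every statement about `Motives.pointCount` of smooth projective curves over finite
fields (e.g. a Lefschetz trace formula for a Weil cohomology, `GaloisWeilCohomology.HasLefschetzTraceFormula`)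
specialises to the point counts `N_m = qᵐ + 1 - Σᵢ αᵢᵐ` of the Picard function field, whose
`L`-polynomial `∏ᵢ (1 - αᵢ t)` the tree controls (`FunctionFieldHasseWeilProofs`,
`SuperellipticFrobeniusClassNumber`).

## References

* H. Stichtenoth, *Algebraic Function Fields and Codes*, 2nd ed., GTM 254 (2009): eq. (5.16),
  Lemma 5.1.9, eq. (5.40). [Stichtenoth2009]
* R. Hartshorne, *Algebraic Geometry*, GTM 52 (1977), App. C §1 (`N_r` and the zeta function).
  [Hartshorne1977]
* A. Weil, *Numbers of solutions of equations in finite fields*, Bull. AMS 55 (1949). [Weil1949]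
-/

noncomputable section

universe u

namespace Literature.NumberTheory.GaloisRepresentations.PicardQuartic

open Literature.AlgebraicGeometry.Motives Literature.AlgebraicGeometry.Motives.PicardQuartic
  Literature.AlgebraicGeometry.Motives.SmoothHypersurface
  Literature.NumberTheory.DiophantineGeometry Literature.NumberTheory.DiophantineGeometry.AlgFunctionField

variable {k : Type u} [Field k] {Ω : Type u} [Field Ω] [Algebra k Ω] [IsAlgClosed Ω] {f : Polynomial k}


/-- **Fixed `Ω`-points of the Picard quartic = fixed places of its function field.** For `Ω ⊇ k`
algebraically closed, `3 ≠ 0` in `k`, `f` a separable quartic and any `σ ∈ Aut(Ω/k)`: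
`#{P ∈ X_F(Ω) : σ P = P} = #{Q place of Ω(C_f)/Ω : σ Q = Q}` — both are `{∞} ⊔ {(a, b) : b³ = f(a),
σ a = a, σ b = b}` (`fixedPointsEquiv`; `SuperellipticFunctionField.nonempty_fixedPlaces_equiv_option`).
[folklore] -/
theorem natCard_fixedPoints_eq_natCard_fixedPlaces [Fact (Irreducible (superellipticPoly k Ω 3 f))]
    (h3 : (3 : k) ≠ 0) (hf : f.natDegree = 4) (hsep : f.Separable) (σ : Ω ≃ₐ[k] Ω) :
    Nat.card {P : AlgPoints (hypersurface (picardForm f)) Ω // σ • P = P} =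
      Nat.card {Q : PlaceOver Ω (SuperellipticFunctionField k Ω 3 f) // σ • Q = Q} := by
  haveI : NeZero ((3 : ℕ) : Ω) := ⟨by rwa [Ne, Nat.cast_ofNat, ← map_ofNat (algebraMap k Ω) 3, map_eq_zero]⟩
  obtain ⟨ζ₀, hζ₀⟩ := HasEnoughRootsOfUnity.exists_primitiveRoot Ω 3
  have hndvd : ¬ 3 ∣ f.natDegree := by rw [hf]; decide
  obtain ⟨e⟩ := SuperellipticFunctionField.nonempty_fixedPlaces_equiv_option (k := k) (p := 3) (f := f)
    hζ₀ hsep hndvd σ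
  rw [Nat.card_congr (fixedPointsEquiv hf σ), Nat.card_congr e]
  rfl

/-- **`#X_F(𝔽_{q^m}) = N_m(k(C_f))`**: for a finite field `k` with `3 ≠ 0` and a separable quartic
`f ∈ k[X]`, the number of `k̄`-points of the smooth plane quartic `X_F = V₊(y³z - z⁴f(x/z))` fixed by
the `m`-th power of the arithmetic Frobenius (`Motives.pointCount`, the count entering the Lefschetz
trace formula and `Z(X_F, T)`) equals the number `N_m = Σ_{d ∣ m} d B_d` of places of degree dividing
`m` of the function field `k(C_f) = k(x)[y]/(y³ - f)` (`AlgFunctionField.pointCount`, the count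
entering `Z_{k(C_f)}(t)`), `m ≥ 1`: the bridge between the scheme-theoretic and the function-field
zeta functions of the Picard curve (Weil 1949; Stichtenoth eq. (5.40)).
[cite: Stichtenoth2009, eq. (5.40) and Lemma 5.1.9] [cite: Hartshorne1977, App. C §1] -/
theorem pointCount_hypersurface_picardForm [Fintype k] [Fact (Irreducible (superellipticPoly k k 3 f))]
    (h3 : (3 : k) ≠ 0) (hf : f.natDegree = 4) (hsep : f.Separable) {m : ℕ} (hm : 0 < m) :
    pointCount (hypersurface (picardForm f)) m =
      AlgFunctionField.pointCount k (SuperellipticFunctionField k k 3 f) m := by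
  have hdeg : 0 < f.natDegree := by omega
  haveI := fact_irreducible_superellipticPoly_algebraicClosure k f (p := 3) hsep hdeg
  have hndvd : ¬ 3 ∣ f.natDegree := by rw [hf]; decide
  -- the arithmetic Frobenius as a `k`-automorphism of `k̄`
  let φ : AlgebraicClosure k ≃ₐ[k] AlgebraicClosure k := arithFrob k
  have hφ : ∀ x : AlgebraicClosure k, φ x = x ^ Fintype.card k := fun x => by
    have h := arithFrob_smul x
    rw [Nat.card_eq_fintype_card] at h
    exact h
  rw [← SuperellipticFunctionField.natCard_fixedPlaces_frobenius_pow_eq_pointCount φ hφ h3 hsep hndvd hm,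
    ← natCard_fixedPoints_eq_natCard_fixedPlaces h3 hf hsep (φ ^ m)]
  rfl


end Literature.NumberTheory.GaloisRepresentations.PicardQuartic

end
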